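import Mathlib
import Summits.Ventures.HodgeRepro.Tier4.Target
import Summits.Ventures.HodgeRepro.Tier4.Line3.KMDatum
import Summits.Ventures.HodgeRepro.Tier4.Line3.KMDatumS
import Summits.Ventures.HodgeRepro.Tier4.Line3.Defs
import Summits.Ventures.HodgeRepro.Tier4.Line3.DefsLemmas
import Summits.Ventures.HodgeRepro.Tier4.Line3.HeckeEquivarianceLemmas
import Summits.Ventures.HodgeRepro.Tier4.Line3.BallCoordLemmas
import Summits.Ventures.HodgeRepro.Tier4.Line3.StabFinite

/-!
# Tier4/Line3/StabFiniteApi — (R-c) in the `LinearIndependent` form consumed by `MainTermAssembly`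

Blind re-derivation cell `pub-hodge-repro`, Tier 4 «PROVE THE STEP», LINE L3, seat t4-L3-p2.  `Tier4/Line3/StabFinite.lean`
(p668279) proves (R-c) of L3.6a with the wedge hypothesis of `HasLocaliser`; t4-L3-p1's assembly `term_main_unfold_of'`
(MainTermAssembly.lean) consumes it under the names `finite_stab` / `finite_stab_mainRep` with the hypothesis
`hab : LinearIndependent X.E ![xm 0, xm 1]` (t4-crit-2 S12666 (2): one path, one module — this module supplies p1's
names and hypothesis shape on top of the landed proofs, so MainTermAssembly changes only its import line).

Nothing here says anything about the status of the Hodge conjecture for CM abelian varieties, which is NOT proved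
(HC_CM is NOT proved by anyone in this repository).
-/

set_option autoImplicit false

noncomputable section

namespace Summit.Ventures.HodgeRepro.Tier4.Line3

open Summit.Ventures.HodgeRepro.Tier4
open Matrix

namespace T4Data

variable (X : T4Data)

/-- (R-c), p1's name: the stabiliser in `Γ′` of a line tuple with independent first two vectors is finite. -/
theorem finite_stab (K : X.Level) (x : X.Tuple) (hx : LinearIndependent X.E ![x 0, x 1]) :
    Finite {γ : Matrix (Fin 3) (Fin 3) X.E // γ ∈ K.1 ∧ X.lines (fun j => γ *ᵥ x j) = X.lines x} :=
  X.finite_lineStab K x hx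

/-- (R-c) for the main classes, p1's name and hypothesis (`LinearIndependent X.E ![xm 0, xm 1]`): the stabiliser in
`Γ′` of every main-class representative `mainRep K xm c` is finite. -/
theorem finite_stab_mainRep (K : X.Level) (xm : X.Tuple) (hab : LinearIndependent X.E ![xm 0, xm 1])
    (c : X.MainClass K xm) :
    Finite {γ : Matrix (Fin 3) (Fin 3) X.E //
      γ ∈ K.1 ∧ X.lines (fun j => γ *ᵥ X.mainRep K xm c j) = X.lines (X.mainRep K xm c)} :=
  X.finite_lineStab K (X.mainRep K xm c) (X.linearIndependent_mulVec (X.isUnit_gRep K xm c) hab)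

end T4Data

end Summit.Ventures.HodgeRepro.Tier4.Line3

end
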